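import Mathlib.NumberTheory.Modular
import Mathlib.Analysis.Complex.OpenMapping
import Mathlib.Analysis.Normed.Module.Connected
import Mathlib.LinearAlgebra.Complex.FiniteDimensional
import Literature.NumberTheory.Automorphic.ModularLambdaGammaTwo
import HarnessLib

/-!
# The modular `λ`-function takes every value except `0` and `1`

Fourth file on `λ = θ₂⁴/θ₃⁴` (`ModularLambda.lean`, `ModularLambdaGammaTwo.lean`). We prove the
classical theorem behind "`Y(2) = ℍ/Γ(2) ≅ ℙ¹ ∖ {0, 1, ∞}` via `λ`" — the description of the base
curve of Calegari–Dimitrov–Tang's argument (F. Calegari, V. Dimitrov, Y. Tang, *The unbounded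
denominators conjecture*, J. Amer. Math. Soc. **38** (2025), arXiv:2109.09040, §1 p. 3: "with
branching only at the three punctures `λ = 0, 1, ∞` of the modular curve `Y(2)`"; §5, Example 41:
"the uniformization `ℍ → ℂ ∖ {±1}` sending `i` to `0` by `2λ(τ) − 1`"):

* **`image_modularLambda_upperHalfPlane : modularLambda '' {z | 0 < Im z} = {0, 1}ᶜ`** — `λ` maps
  the upper half-plane ONTO `ℂ ∖ {0, 1}` (Ahlfors, *Complex Analysis*, Ch. 7 §3.4; the key input
  of Picard's little theorem); `range_modularLambda`, `exists_modularLambda_eq`.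

together with the group theory of the values of `λ` on `SL(2, ℤ)`-orbits:

* `modularLambda_T_smul` (`λ(Tz) = 1 − (1 − λ)⁻¹ = λ/(λ − 1)`), `modularLambda_ST_smul`
  (`(1 − λ)⁻¹`), `modularLambda_TS_smul` (`1 − λ⁻¹`), `modularLambda_STS_smul` (`λ⁻¹`),
  `modularLambda_I` (`λ(i) = 1/2`);
* `modularLambda_smul_eq_or` — **the anharmonic six**: for every `g ∈ SL(2, ℤ)`,
  `λ(g • z) ∈ {λ, 1 − λ, λ⁻¹, (1 − λ)⁻¹, 1 − λ⁻¹, 1 − (1 − λ)⁻¹}` (at `z`);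
* `isOpen_image_modularLambda` (open mapping), `closure_image_modularLambda_fd_subset` (the
  values on the standard fundamental domain `𝒟` of `SL(2, ℤ)` accumulate only at `0`).

## Proof of surjectivity

`λ(ℍ)` is open (open mapping theorem; `λ` is not constant as `λ(i) = 1/2` while `λ → 0` at `i∞`).
It is relatively closed in the connected set `ℂ ∖ {0,1}`: by Mathlib's `exists_smul_mem_fd` and the
anharmonic six, `λ(ℍ) = ⋃_F F(λ(𝒟))` over the six Möbius maps `F` (words in `x ↦ 1 − x`,
`x ↦ x⁻¹`, each an involutive self-map of `ℂ ∖ {0,1}` continuous there), and `λ(𝒟)` accumulates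
only at `0`: on `𝒟 ∩ {Im ≤ B}` (compact) `λ` is continuous, while on `{Im ≥ B}` it is uniformly
small (`tendsto_modularLambda`). Hence `ℂ ∖ {0,1} ⊆ λ(ℍ)`
(`IsPreconnected.subset_of_closure_inter_subset`), and `λ ≠ 0, 1` gives equality.

## References

* L. V. Ahlfors, *Complex Analysis*, 3rd ed., McGraw–Hill 1979, Ch. 7 §3.4 (the modular function
  `λ`, Theorem 7 and §3.5).
* [CalegariDimitrovTang2025] arXiv:2109.09040, §1 p. 3 and §5 Example 41.
-/

noncomputable section

open Complex Real Filter Topology Function Metric Set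
open UpperHalfPlane hiding I
open scoped Real Topology Modular MatrixGroups

namespace Literature.NumberTheory.Automorphic

namespace ModularLambda

open Literature.NumberTheory.EllipticCurves.JacobiThetaNull

/-! ### Values of `λ` under `S`, `T` and their products -/

/-- **`λ(i) = 1/2`** (`i` is fixed by `S` and `λ(Sz) = 1 − λ(z)`). [folklore] -/
theorem modularLambda_I : modularLambda Complex.I = 1 / 2 := by
  have h := modularLambda_neg_one_div (τ := Complex.I) (by simp)
  have hI : (-1 / Complex.I : ℂ) = Complex.I := by
    rw [div_eq_iff Complex.I_ne_zero, Complex.I_mul_I]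
  rw [hI] at h
  linear_combination h / 2

/-- **`λ(T • z) = 1 − (1 − λ(z))⁻¹`** (`= λ/(λ − 1)`) for `z ∈ ℍ`. [folklore] -/
theorem modularLambda_T_smul (z : ℍ) :
    modularLambda ((ModularGroup.T • z : ℍ) : ℂ) = 1 - (1 - modularLambda z)⁻¹ := by
  rw [modular_T_smul, coe_vadd, ofReal_one, add_comm, modularLambda_add_one z.2]
  have h1 : modularLambda z - 1 ≠ 0 := sub_ne_zero.mpr (modularLambda_ne_one z.2)
  have h2 : 1 - modularLambda z ≠ 0 := sub_ne_zero.mpr (modularLambda_ne_one z.2).symm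
  field_simp
  ring

/-- `λ(T⁻¹ • z) = 1 − (1 − λ(z))⁻¹` (`T² ∈ Γ(2)` fixes `λ`). [folklore] -/
theorem modularLambda_T_inv_smul (z : ℍ) :
    modularLambda ((ModularGroup.T⁻¹ • z : ℍ) : ℂ) = 1 - (1 - modularLambda z)⁻¹ := by
  rw [← modularLambda_T_smul, ← modularLambda_T_sq_smul (ModularGroup.T⁻¹ • z), ← mul_smul,
    pow_two, mul_assoc, mul_inv_cancel, mul_one]

/-- `λ(S⁻¹ • z) = 1 − λ(z)`. [folklore] -/
theorem modularLambda_S_inv_smul (z : ℍ) :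
    modularLambda ((ModularGroup.S⁻¹ • z : ℍ) : ℂ) = 1 - modularLambda z := by
  rw [ModularGroup.S_inv, ModularGroup.SL_neg_smul, modularLambda_S_smul]

/-- `λ(ST • z) = (1 − λ(z))⁻¹`. [folklore] -/
theorem modularLambda_ST_smul (z : ℍ) :
    modularLambda ((ModularGroup.S * ModularGroup.T) • z : ℍ) = (1 - modularLambda z)⁻¹ := by
  rw [mul_smul, modularLambda_S_smul, modularLambda_T_smul, sub_sub_cancel]

/-- `λ(TS • z) = 1 − λ(z)⁻¹`. [folklore] -/
theorem modularLambda_TS_smul (z : ℍ) :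
    modularLambda ((ModularGroup.T * ModularGroup.S) • z : ℍ) = 1 - (modularLambda z)⁻¹ := by
  rw [mul_smul, modularLambda_T_smul, modularLambda_S_smul, sub_sub_cancel]

/-- `λ(STS • z) = λ(z)⁻¹`. [folklore] -/
theorem modularLambda_STS_smul (z : ℍ) :
    modularLambda ((ModularGroup.S * ModularGroup.T * ModularGroup.S) • z : ℍ) =
      (modularLambda z)⁻¹ := by
  rw [mul_smul, modularLambda_ST_smul, modularLambda_S_smul, sub_sub_cancel]

/-! ### The anharmonic six -/

/-- The six anharmonic words are permuted by precomposition with `x ↦ 1 − x`. [folklore] -/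
private theorem six_of_sigma {x y : ℂ}
    (h : y = 1 - x ∨ y = 1 - (1 - x) ∨ y = (1 - x)⁻¹ ∨ y = (1 - (1 - x))⁻¹ ∨
      y = 1 - (1 - x)⁻¹ ∨ y = 1 - (1 - (1 - x))⁻¹) :
    y = x ∨ y = 1 - x ∨ y = x⁻¹ ∨ y = (1 - x)⁻¹ ∨ y = 1 - x⁻¹ ∨ y = 1 - (1 - x)⁻¹ := by
  rcases h with h | h | h | h | h | h <;> (try simp only [sub_sub_cancel] at h) <;>
    simp only [h, true_or, or_true]

/-- The six anharmonic words are permuted by precomposition with `x ↦ 1 − (1 − x)⁻¹ = x/(x−1)`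
(for `x ≠ 0, 1`). [folklore] -/
private theorem six_of_tau {x y : ℂ} (hx0 : x ≠ 0) (hx1 : x ≠ 1)
    (h : y = 1 - (1 - x)⁻¹ ∨ y = 1 - (1 - (1 - x)⁻¹) ∨ y = (1 - (1 - x)⁻¹)⁻¹ ∨
      y = (1 - (1 - (1 - x)⁻¹))⁻¹ ∨ y = 1 - (1 - (1 - x)⁻¹)⁻¹ ∨
      y = 1 - (1 - (1 - (1 - x)⁻¹))⁻¹) :
    y = x ∨ y = 1 - x ∨ y = x⁻¹ ∨ y = (1 - x)⁻¹ ∨ y = 1 - x⁻¹ ∨ y = 1 - (1 - x)⁻¹ := by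
  have h1x : 1 - x ≠ 0 := sub_ne_zero.mpr hx1.symm
  have hid : (1 - (1 - x)⁻¹)⁻¹ = 1 - x⁻¹ := by
    have e1 : 1 - (1 - x)⁻¹ = -x * (1 - x)⁻¹ := by
      have h := mul_inv_cancel₀ h1x
      linear_combination -h
    have h2 := inv_mul_cancel₀ hx0
    rw [e1, mul_inv, inv_inv, inv_neg]
    linear_combination h2
  rcases h with h | h | h | h | h | h <;> (try simp only [sub_sub_cancel, inv_inv, hid] at h) <;>
    simp only [h, true_or, or_true]

/-- **The anharmonic six.** For every `g ∈ SL(2, ℤ)` and `z ∈ ℍ`, `λ(g • z)` is one of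
`λ, 1 − λ, λ⁻¹, (1 − λ)⁻¹, 1 − λ⁻¹, 1 − (1 − λ)⁻¹` evaluated at `z` (the six values of the
cross-ratio; `SL(2, ℤ)/Γ(2) ≅ S₃`). Proof: induction over the generators `S`, `T` of `SL(2, ℤ)`
(Mathlib `SL2Z_generators`) with `λ(Sz) = 1 − λ`, `λ(Tz) = 1 − (1 − λ)⁻¹`. [folklore] -/
theorem modularLambda_smul_eq_or (g : SL(2, ℤ)) (z : ℍ) :
    modularLambda ((g • z : ℍ) : ℂ) = modularLambda z ∨
    modularLambda ((g • z : ℍ) : ℂ) = 1 - modularLambda z ∨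
    modularLambda ((g • z : ℍ) : ℂ) = (modularLambda z)⁻¹ ∨
    modularLambda ((g • z : ℍ) : ℂ) = (1 - modularLambda z)⁻¹ ∨
    modularLambda ((g • z : ℍ) : ℂ) = 1 - (modularLambda z)⁻¹ ∨
    modularLambda ((g • z : ℍ) : ℂ) = 1 - (1 - modularLambda z)⁻¹ := by
  have hg : g ∈ Subgroup.closure ({ModularGroup.S, ModularGroup.T} : Set SL(2, ℤ)) := by
    rw [SpecialLinearGroup.SL2Z_generators]
    exact Subgroup.mem_top g
  revert z
  refine Subgroup.closure_induction_right
    (p := fun (g : SL(2, ℤ)) _ ↦ ∀ z : ℍ,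
      modularLambda ((g • z : ℍ) : ℂ) = modularLambda z ∨
      modularLambda ((g • z : ℍ) : ℂ) = 1 - modularLambda z ∨
      modularLambda ((g • z : ℍ) : ℂ) = (modularLambda z)⁻¹ ∨
      modularLambda ((g • z : ℍ) : ℂ) = (1 - modularLambda z)⁻¹ ∨
      modularLambda ((g • z : ℍ) : ℂ) = 1 - (modularLambda z)⁻¹ ∨
      modularLambda ((g • z : ℍ) : ℂ) = 1 - (1 - modularLambda z)⁻¹)
    ?_ ?_ ?_ hg
  · intro z
    exact Or.inl (by rw [one_smul])
  · intro x _ y hy hx z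
    rw [mul_smul]
    rcases hy with rfl | rfl
    · have h := hx (ModularGroup.S • z)
      rw [modularLambda_S_smul] at h
      exact six_of_sigma h
    · have h := hx (ModularGroup.T • z)
      rw [modularLambda_T_smul] at h
      exact six_of_tau (modularLambda_ne_zero z.2) (modularLambda_ne_one z.2) h
  · intro x _ y hy hx z
    rw [mul_smul]
    rcases hy with rfl | rfl
    · have h := hx (ModularGroup.S⁻¹ • z)
      rw [modularLambda_S_inv_smul] at h
      exact six_of_sigma h
    · have h := hx (ModularGroup.T⁻¹ • z)
      rw [modularLambda_T_inv_smul] at h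
      exact six_of_tau (modularLambda_ne_zero z.2) (modularLambda_ne_one z.2) h

/-! ### Topology of `λ` on the upper half-plane -/

/-- `λ` is continuous on the open upper half-plane. [folklore] -/
theorem continuousOn_modularLambda : ContinuousOn modularLambda {z : ℂ | 0 < z.im} :=
  fun _ hz ↦ (differentiableAt_modularLambda hz).continuousAt.continuousWithinAt

/-- `λ` is complex-differentiable on the open upper half-plane. [folklore] -/
theorem differentiableOn_modularLambda : DifferentiableOn ℂ modularLambda {z : ℂ | 0 < z.im} :=
  fun _ hz ↦ (differentiableAt_modularLambda hz).differentiableWithinAt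

/-- Uniform smallness of `λ` high in the upper half-plane: `‖λ(z)‖ < ε` once `Im z ≥ B(ε)`.
[folklore] -/
theorem exists_forall_norm_modularLambda_lt {ε : ℝ} (hε : 0 < ε) :
    ∃ B : ℝ, ∀ z : ℂ, B ≤ z.im → ‖modularLambda z‖ < ε := by
  have hev : ∀ᶠ z : ℂ in comap im atTop, modularLambda z ∈ ball (0 : ℂ) ε :=
    tendsto_modularLambda (ball_mem_nhds _ hε)
  obtain ⟨B, hB⟩ := eventually_atTop.mp (Filter.eventually_comap.mp hev)
  exact ⟨B, fun z hz ↦ by simpa using hB z.im hz z rfl⟩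

/-- **Open mapping.** `λ` maps open subsets of the upper half-plane to open sets (`λ` is not
constant: `λ(i) = 1/2`, `λ → 0` at `i∞`). [folklore] -/
theorem isOpen_image_modularLambda {s : Set ℂ} (hs : s ⊆ {z : ℂ | 0 < z.im}) (hso : IsOpen s) :
    IsOpen (modularLambda '' s) := by
  have han : AnalyticOnNhd ℂ modularLambda {z : ℂ | 0 < z.im} :=
    differentiableOn_modularLambda.analyticOnNhd (isOpen_lt continuous_const Complex.continuous_im)
  rcases han.is_constant_or_isOpen (convex_halfSpace_im_gt 0).isPreconnected with ⟨w, hw⟩ | h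
  · exfalso
    obtain ⟨B, hB⟩ := exists_forall_norm_modularLambda_lt (by norm_num : (0 : ℝ) < 1 / 2)
    set z : ℂ := Complex.I * ((max B 1 : ℝ) : ℂ) with hz
    have hzim : z.im = max B 1 := by simp [hz]
    have hzpos : 0 < z.im := by rw [hzim]; positivity
    have h1 : modularLambda z = 1 / 2 := by
      rw [hw z hzpos, ← hw Complex.I (by simp), modularLambda_I]
    have h2 := hB z (by rw [hzim]; exact le_max_left _ _)
    rw [h1] at h2
    norm_num at h2
  · exact h s hs hso

/-- On the closed fundamental domain of `SL(2, ℤ)`, `Im z ≥ 1/2` (indeed `≥ √3/2`). [folklore] -/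
private theorem half_le_im_of_mem {z : ℂ} (h0 : 0 < z.im) (h1 : 1 ≤ normSq z)
    (h2 : |z.re| ≤ 1 / 2) : 1 / 2 ≤ z.im := by
  rw [Complex.normSq_apply] at h1
  obtain ⟨h2a, h2b⟩ := abs_le.mp h2
  nlinarith

/-- **The values of `λ` on the fundamental domain accumulate only at `0`.** With
`D = {z : 0 < Im z, |z| ≥ 1, |Re z| ≤ 1/2}` (Mathlib's `ModularGroup.fd`, as a subset of `ℂ`),
`closure (λ(D)) ⊆ λ(D) ∪ {0}`: on `D ∩ {Im ≤ B}` (compact) `λ` is continuous, and on `{Im ≥ B}` it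
is uniformly small. [folklore] -/
theorem closure_image_modularLambda_fd_subset :
    closure (modularLambda '' {z : ℂ | 0 < z.im ∧ 1 ≤ normSq z ∧ |z.re| ≤ 1 / 2}) ⊆
      modularLambda '' {z : ℂ | 0 < z.im ∧ 1 ≤ normSq z ∧ |z.re| ≤ 1 / 2} ∪ {0} := by
  intro w hw
  by_cases hw0 : w = 0
  · exact Or.inr hw0
  left
  set D : Set ℂ := {z : ℂ | 0 < z.im ∧ 1 ≤ normSq z ∧ |z.re| ≤ 1 / 2} with hD
  have hε : 0 < ‖w‖ / 2 := by positivity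
  obtain ⟨B₀, hB₀⟩ := exists_forall_norm_modularLambda_lt hε
  set B : ℝ := max B₀ 1 with hB
  set K : Set ℂ := {z : ℂ | 1 / 2 ≤ z.im ∧ z.im ≤ B ∧ 1 ≤ normSq z ∧ |z.re| ≤ 1 / 2} with hK
  have hKD : K ⊆ D := fun z hz ↦ ⟨by linarith [hz.1], hz.2.2.1, hz.2.2.2⟩
  have hDsub : D ⊆ K ∪ {z : ℂ | B ≤ z.im} := by
    intro z hz
    by_cases hzB : z.im ≤ B
    · exact Or.inl ⟨half_le_im_of_mem hz.1 hz.2.1 hz.2.2, hzB, hz.2.1, hz.2.2⟩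
    · exact Or.inr (not_le.mp hzB).le
  -- `K` is compact, so `λ(K)` is closed
  have hKc : IsCompact K := by
    refine Metric.isCompact_of_isClosed_isBounded ?_ ?_
    · simp only [hK, Set.setOf_and]
      exact (isClosed_le continuous_const Complex.continuous_im).inter
        ((isClosed_le Complex.continuous_im continuous_const).inter
          ((isClosed_le continuous_const Complex.continuous_normSq).inter
            (isClosed_le (continuous_abs.comp Complex.continuous_re) continuous_const)))
    · rw [Metric.isBounded_iff_subset_closedBall 0]
      refine ⟨B + 1, fun z hz ↦ ?_⟩
      rw [mem_closedBall_zero_iff]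
      have h1 := norm_le_abs_re_add_abs_im z
      have h2 : |z.im| = z.im := abs_of_pos (by linarith [hz.1])
      linarith [hz.2.1, hz.2.2.2]
  have hlamK : IsClosed (modularLambda '' K) :=
    (hKc.image_of_continuousOn (continuousOn_modularLambda.mono fun z hz ↦ (hKD hz).1)).isClosed
  -- `λ({Im ≥ B}) ⊆ ball 0 (‖w‖/2)`
  have hhigh : modularLambda '' {z : ℂ | B ≤ z.im} ⊆ ball 0 (‖w‖ / 2) := by
    rintro _ ⟨z, hz, rfl⟩
    rw [mem_ball_zero_iff]
    exact hB₀ z ((le_max_left _ _).trans hz)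
  have hsub1 : modularLambda '' D ⊆ modularLambda '' K ∪ ball 0 (‖w‖ / 2) := by
    refine (image_mono hDsub).trans ?_
    rw [image_union]
    exact union_subset_union_right _ hhigh
  have hcl : closure (modularLambda '' D) ⊆ modularLambda '' K ∪ closedBall 0 (‖w‖ / 2) := by
    refine (closure_mono hsub1).trans ?_
    rw [closure_union, hlamK.closure_eq]
    exact union_subset_union_right _ closure_ball_subset_closedBall
  rcases hcl hw with h | h
  · exact image_mono hKD h
  · exfalso
    rw [mem_closedBall_zero_iff] at h
    have : 0 < ‖w‖ := norm_pos_iff.mpr hw0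
    linarith

/-! ### Stability of "accumulates only at `0, 1`" under the two generating involutions -/

/-- If `B ⊆ ℂ ∖ {0,1}` accumulates only at `{0,1}`, so does `B⁻¹`. [folklore] -/
private theorem inv_step {B : Set ℂ} (hB : B ⊆ ({0, 1} : Set ℂ)ᶜ)
    (hBc : closure B ⊆ B ∪ {0, 1}) :
    (fun x : ℂ ↦ x⁻¹) '' B ⊆ ({0, 1} : Set ℂ)ᶜ ∧
      closure ((fun x : ℂ ↦ x⁻¹) '' B) ⊆ (fun x : ℂ ↦ x⁻¹) '' B ∪ {0, 1} := by
  constructor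
  · rintro _ ⟨x, hx, rfl⟩
    have h := hB hx
    simp only [mem_compl_iff, mem_insert_iff, mem_singleton_iff, not_or] at h ⊢
    exact ⟨inv_ne_zero h.1, fun h1 ↦ h.2 (inv_eq_one.mp h1)⟩
  · intro w hw
    by_cases h01 : w = 0 ∨ w = 1
    · exact Or.inr (by simpa using h01)
    simp only [not_or] at h01
    have hc : ContinuousAt (fun x : ℂ ↦ x⁻¹) w := continuousAt_inv₀ h01.1
    have h := mem_closure_image hc hw
    rw [image_image] at h
    simp only [inv_inv, image_id'] at h
    rcases hBc h with h | h
    · exact Or.inl ⟨w⁻¹, h, inv_inv w⟩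
    · exfalso
      simp only [mem_insert_iff, mem_singleton_iff, inv_eq_zero, inv_eq_one] at h
      exact h.elim h01.1 h01.2

/-- If `B ⊆ ℂ ∖ {0,1}` accumulates only at `{0,1}`, so does `1 − B`. [folklore] -/
private theorem sub_step {B : Set ℂ} (hB : B ⊆ ({0, 1} : Set ℂ)ᶜ)
    (hBc : closure B ⊆ B ∪ {0, 1}) :
    (fun x : ℂ ↦ 1 - x) '' B ⊆ ({0, 1} : Set ℂ)ᶜ ∧
      closure ((fun x : ℂ ↦ 1 - x) '' B) ⊆ (fun x : ℂ ↦ 1 - x) '' B ∪ {0, 1} := by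
  constructor
  · rintro _ ⟨x, hx, rfl⟩
    have h := hB hx
    simp only [mem_compl_iff, mem_insert_iff, mem_singleton_iff, not_or] at h ⊢
    exact ⟨fun h0 ↦ h.2 (by linear_combination -h0), fun h1 ↦ h.1 (by linear_combination -h1)⟩
  · intro w hw
    by_cases h01 : w = 0 ∨ w = 1
    · exact Or.inr (by simpa using h01)
    simp only [not_or] at h01
    have hc : ContinuousAt (fun x : ℂ ↦ 1 - x) w :=
      (continuous_const.sub continuous_id).continuousAt
    have h := mem_closure_image hc hw
    rw [image_image] at h
    simp only [sub_sub_cancel, image_id'] at h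
    rcases hBc h with h | h
    · exact Or.inl ⟨1 - w, h, sub_sub_cancel 1 w⟩
    · exfalso
      simp only [mem_insert_iff, mem_singleton_iff] at h
      rcases h with h | h
      · exact h01.2 (by linear_combination -h)
      · exact h01.1 (by linear_combination -h)

/-- Unions preserve "accumulates only at `{0,1}`". [folklore] -/
private theorem union_step {B₁ B₂ : Set ℂ} (h₁ : B₁ ⊆ ({0, 1} : Set ℂ)ᶜ)
    (h₁c : closure B₁ ⊆ B₁ ∪ {0, 1}) (h₂ : B₂ ⊆ ({0, 1} : Set ℂ)ᶜ)
    (h₂c : closure B₂ ⊆ B₂ ∪ {0, 1}) :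
    B₁ ∪ B₂ ⊆ ({0, 1} : Set ℂ)ᶜ ∧ closure (B₁ ∪ B₂) ⊆ (B₁ ∪ B₂) ∪ {0, 1} := by
  refine ⟨union_subset h₁ h₂, ?_⟩
  rw [closure_union]
  intro w hw
  rcases hw with hw | hw
  · rcases h₁c hw with h | h
    · exact Or.inl (Or.inl h)
    · exact Or.inr h
  · rcases h₂c hw with h | h
    · exact Or.inl (Or.inr h)
    · exact Or.inr h

/-! ### Surjectivity onto `ℂ ∖ {0, 1}` -/

/-- **`λ` maps the upper half-plane onto `ℂ ∖ {0, 1}`**: `λ({Im z > 0}) = {0, 1}ᶜ`.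
[folklore] (Ahlfors, *Complex Analysis*, Ch. 7 §3.4; cf. [CalegariDimitrovTang2025, §1 p. 3]:
`Y(2) ≅ ℙ¹ ∖ {0, 1, ∞}` via `λ`.) -/
theorem image_modularLambda_upperHalfPlane :
    modularLambda '' {z : ℂ | 0 < z.im} = ({0, 1} : Set ℂ)ᶜ := by
  apply Subset.antisymm
  · rintro _ ⟨z, hz, rfl⟩
    simp only [mem_compl_iff, mem_insert_iff, mem_singleton_iff, not_or]
    exact ⟨modularLambda_ne_zero hz, modularLambda_ne_one hz⟩
  -- notation-free abbreviations
  set Ω : Set ℂ := {z : ℂ | 0 < z.im} with hΩ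
  set D : Set ℂ := {z : ℂ | 0 < z.im ∧ 1 ≤ normSq z ∧ |z.re| ≤ 1 / 2} with hD
  set A : Set ℂ := modularLambda '' D with hA
  set σ : ℂ → ℂ := fun x ↦ 1 - x with hσ
  set ι : ℂ → ℂ := fun x ↦ x⁻¹ with hι
  set U : Set ℂ := A ∪ σ '' A ∪ ι '' A ∪ ι '' (σ '' A) ∪ σ '' (ι '' A) ∪ σ '' (ι '' (σ '' A))
    with hU
  -- (1) `A` lies in `ℂ ∖ {0,1}` and accumulates only at `0`
  have hA01 : A ⊆ ({0, 1} : Set ℂ)ᶜ := by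
    rintro _ ⟨z, hz, rfl⟩
    simp only [mem_compl_iff, mem_insert_iff, mem_singleton_iff, not_or]
    exact ⟨modularLambda_ne_zero hz.1, modularLambda_ne_one hz.1⟩
  have hAc : closure A ⊆ A ∪ {0, 1} := fun w hw ↦ by
    rcases closure_image_modularLambda_fd_subset hw with h | h
    · exact Or.inl h
    · exact Or.inr (Or.inl h)
  -- (2) hence `U` accumulates only at `{0,1}`
  have hU01c : U ⊆ ({0, 1} : Set ℂ)ᶜ ∧ closure U ⊆ U ∪ {0, 1} := by
    have h2 := sub_step hA01 hAc
    have h3 := inv_step hA01 hAc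
    have h4 := inv_step h2.1 h2.2
    have h5 := sub_step h3.1 h3.2
    have h6 := sub_step h4.1 h4.2
    have u1 := union_step hA01 hAc h2.1 h2.2
    have u2 := union_step u1.1 u1.2 h3.1 h3.2
    have u3 := union_step u2.1 u2.2 h4.1 h4.2
    have u4 := union_step u3.1 u3.2 h5.1 h5.2
    exact union_step u4.1 u4.2 h6.1 h6.2
  -- (3) `U ⊆ λ(Ω)`: each of the six is a value `λ(r • z)`
  have hval : ∀ (g : SL(2, ℤ)) (z : ℍ), modularLambda ((g • z : ℍ) : ℂ) ∈ modularLambda '' Ω :=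
    fun g z ↦ ⟨(g • z : ℍ), (g • z).2, rfl⟩
  have hUΩ : U ⊆ modularLambda '' Ω := by
    have hmk : ∀ z ∈ D, ∃ z' : ℍ, (z' : ℂ) = z := fun z hz ↦ ⟨⟨z, hz.1⟩, rfl⟩
    rintro y (((((⟨z, hz, rfl⟩ | ⟨_, ⟨z, hz, rfl⟩, rfl⟩) | ⟨_, ⟨z, hz, rfl⟩, rfl⟩) |
      ⟨_, ⟨_, ⟨z, hz, rfl⟩, rfl⟩, rfl⟩) | ⟨_, ⟨_, ⟨z, hz, rfl⟩, rfl⟩, rfl⟩) |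
      ⟨_, ⟨_, ⟨_, ⟨z, hz, rfl⟩, rfl⟩, rfl⟩, rfl⟩) <;>
      obtain ⟨z', rfl⟩ := hmk z hz
    · exact ⟨z', hz.1, rfl⟩
    · show 1 - modularLambda (z' : ℂ) ∈ _
      rw [← modularLambda_S_smul]
      exact hval _ _
    · show (modularLambda (z' : ℂ))⁻¹ ∈ _
      rw [← modularLambda_STS_smul]
      exact hval _ _
    · show (1 - modularLambda (z' : ℂ))⁻¹ ∈ _
      rw [← modularLambda_ST_smul]
      exact hval _ _
    · show 1 - (modularLambda (z' : ℂ))⁻¹ ∈ _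
      rw [← modularLambda_TS_smul]
      exact hval _ _
    · show 1 - (1 - modularLambda (z' : ℂ))⁻¹ ∈ _
      rw [← modularLambda_T_smul]
      exact hval _ _
  -- (4) `λ(Ω) ⊆ U`: move `z` to the fundamental domain and use the anharmonic six
  have hΩU : modularLambda '' Ω ⊆ U := by
    rintro _ ⟨τ, hτ, rfl⟩
    obtain ⟨g, hg⟩ := ModularGroup.exists_smul_mem_fd ⟨τ, hτ⟩
    set z : ℍ := g • ⟨τ, hτ⟩ with hz
    have hzD : (z : ℂ) ∈ D := ⟨z.2, hg.1, hg.2⟩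
    have hxA : modularLambda z ∈ A := ⟨z, hzD, rfl⟩
    have hτz : (⟨τ, hτ⟩ : ℍ) = g⁻¹ • z := by rw [hz, inv_smul_smul]
    have hcoe : τ = ((g⁻¹ • z : ℍ) : ℂ) := by rw [← hτz]
    rw [hcoe]
    rcases modularLambda_smul_eq_or g⁻¹ z with h | h | h | h | h | h <;> rw [h]
    · exact Or.inl (Or.inl (Or.inl (Or.inl (Or.inl hxA))))
    · exact Or.inl (Or.inl (Or.inl (Or.inl (Or.inr ⟨_, hxA, rfl⟩))))
    · exact Or.inl (Or.inl (Or.inl (Or.inr ⟨_, hxA, rfl⟩)))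
    · exact Or.inl (Or.inl (Or.inr ⟨_, ⟨_, hxA, rfl⟩, rfl⟩))
    · exact Or.inl (Or.inr ⟨_, ⟨_, hxA, rfl⟩, rfl⟩)
    · exact Or.inr ⟨_, ⟨_, ⟨_, hxA, rfl⟩, rfl⟩, rfl⟩
  -- (5) connectedness
  have hpre : IsPreconnected (({0, 1} : Set ℂ)ᶜ) :=
    (Set.Countable.isConnected_compl_of_one_lt_rank
      (by simp only [rank_real_complex, Nat.one_lt_ofNat])
      (((Set.finite_singleton (1 : ℂ)).insert 0).countable)).isPreconnected
  have hopen : IsOpen (modularLambda '' Ω) :=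
    isOpen_image_modularLambda subset_rfl (isOpen_lt continuous_const Complex.continuous_im)
  have hne : (({0, 1} : Set ℂ)ᶜ ∩ modularLambda '' Ω).Nonempty := by
    refine ⟨1 / 2, ?_, ⟨Complex.I, by simp [hΩ], modularLambda_I⟩⟩
    simp only [mem_compl_iff, mem_insert_iff, mem_singleton_iff, not_or]
    norm_num
  refine hpre.subset_of_closure_inter_subset hopen hne ?_
  rintro w ⟨hw, hw01⟩
  rcases hU01c.2 (closure_mono hΩU hw) with h | h
  · exact hUΩ h
  · exact absurd h hw01

/-- **The range of `λ` on `ℍ` is `ℂ ∖ {0, 1}`.** [folklore] -/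
theorem range_modularLambda :
    Set.range (fun τ : ℍ ↦ modularLambda τ) = ({0, 1} : Set ℂ)ᶜ := by
  rw [← image_modularLambda_upperHalfPlane]
  ext w
  constructor
  · rintro ⟨τ, rfl⟩
    exact ⟨τ, τ.2, rfl⟩
  · rintro ⟨z, hz, rfl⟩
    exact ⟨⟨z, hz⟩, rfl⟩

/-- **Every `w ≠ 0, 1` is a value of `λ`** on the upper half-plane. [folklore] -/
theorem exists_modularLambda_eq {w : ℂ} (h0 : w ≠ 0) (h1 : w ≠ 1) :
    ∃ τ : ℂ, 0 < im τ ∧ modularLambda τ = w := by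
  have hw : w ∈ ({0, 1} : Set ℂ)ᶜ := by
    simp only [mem_compl_iff, mem_insert_iff, mem_singleton_iff, not_or]
    exact ⟨h0, h1⟩
  rw [← image_modularLambda_upperHalfPlane] at hw
  obtain ⟨τ, hτ, rfl⟩ := hw
  exact ⟨τ, hτ, rfl⟩

end ModularLambda

end Literature.NumberTheory.Automorphic

end
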